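import Literature.NumberTheory.Transcendental.ExpAlgebraicTranscendenceMeasure
import Literature.NumberTheory.Transcendental.PiTranscendenceMeasureProofs
import Literature.NumberTheory.Transcendental.PiAlgebraicApproximationMeasure
import Literature.NumberTheory.Transcendental.ExpAlgebraicTranscendenceMeasureCore
import Literature.NumberTheory.Transcendental.ExpAlgebraicTranscendenceMeasureParams
import HarnessLib

/-!
# Waldschmidt 1978, Corollary 3.9 (transcendence measure for `e^β`) — proofs, part A
# (the transference, Lemma 2.3) and part V (the approximation measure for `e^β` and the
# discharge `Waldschmidt1978_cor_3_9_holds`)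

`Literature/NumberTheory/Transcendental/ExpAlgebraicTranscendenceMeasureProofs.lean` — sibling
PROOFS file of `ExpAlgebraicTranscendenceMeasure.lean` (the named fact
`Literature.NumberTheory.Transcendental.Waldschmidt1978_cor_3_9`: M. Waldschmidt, *Transcendence
measures for exponentials and logarithms*, J. Austral. Math. Soc. (A) **25** (1978) 445–465,
Corollary 3.9, p. 455). Everything here is PROVED; no definitions, no named facts.

The printed proof of Corollary 3.9 (pp. 449–455) has two layers:

* **Theorem 3.8** (p. 455), an *approximation measure* for `e^β` (`β ≠ 0` algebraic):
  `|e^β − ξ| ≥ exp{−C₁₆(β) N² (Log M)(Log Log M + Log N)² (Log Log M)⁻²}` for every algebraic `ξ`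
  of degree `≤ N` and (Mahler) measure `≤ M`, `M ≥ 16` — deduced there from the lower bound for
  `|β − log α|` of [W] = Waldschmidt, Acta Arith. 37 (1980) ("Theorem A", p. 451);
* **Lemma 2.3** (p. 449), the passage from an approximation measure `ψ(N, Log M)` to the
  transcendence measure `ψ(N, Log H + Log N) + 2N(Log H + N)` ("what is important here is that
  we have `ψ(N, Log H + Log N)` instead of `ψ(N, Log H + N)`"), through Güting's lemma
  `Log M(ξ) ≤ (1/k) Log M(P)` for a root `ξ` of `P` of multiplicity `k` and the Mahler measure
  of the factors of `P`; and then (p. 455) `Log Log M ≍ log(Log H + Log N) ≥ ½(Log Log H + Log₊ Log N)`.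

This part A PROVES the second layer, in a form adapted to the existential constant of the Lean
statement of the fact:

* `Waldschmidt1978.factor_lower_bound_mahler`, `Waldschmidt1978.transference_mahler` — Lemma 2.3
  with the MAHLER MEASURE throughout (so that a factor `Q` of `P` has `M(Q) ≤ M(P) ≤ L(P) ≤ (N+1)H`,
  no `2^N`): if every irreducible `Q ∈ ℤ[X]` of degree `n ≤ N` with `log M(Q) ≤ Y` has all its
  roots at distance `≥ exp(−n Φ)` from `ω`, then `|P(ω)| ≥ exp(−deg P · (Φ + log 2 + ½ log N + Y))`
  for every non-zero `P ∈ ℤ[X]` of degree `≤ N` with `log M(P) ≤ Y`. The per-factor step is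
  Bugeaud's Lemma A.8 with `ℓ = 1` (`Literature.NumberTheory.DiophantineApproximation.norm_sub_root_pow_le`,
  in the tree: `|ω − α| ≤ 2ⁿ n^{n/2} M(Q)ⁿ |Q(ω)|` for the root `α` of `Q` nearest to `ω` when
  `|Q(ω)| ≤ 1`), replacing the printed appeal to Güting / [M-W] Lemma 9; the product over an
  irreducible factorisation is the induction of the tree's
  `NesterenkoWaldschmidt1996.transcendenceMeasure_of_approximationMeasure` (`PiTranscendenceMeasureProofs`).
* `Waldschmidt1978.cor_3_9_of_approx` — **Corollary 3.9 for `ω` from an approximation measure of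
  the shape of Theorem 3.8 for `ω`**: if for some `C₀ ≥ 0` every root `ξ` of every irreducible
  `Q ∈ ℤ[X]` of degree `n ≥ 1` satisfies `|ω − ξ| ≥ exp{−C₀ n² Y (log Y + log n)²/(log Y)²}` for all
  `Y ≥ max(log 16, log M(Q))`, then the conclusion of `Waldschmidt1978_cor_3_9` holds for `ω` with
  `C = 32 C₀ + 3`: with `Y = log((N+1)H)`, `a = log Y`, the bound for a factor of degree `n ≤ N` is
  `≤ n · Φ`, `Φ = C₀ N Y (a + log N)²/a²` (this linearity in `n` is what makes the factor bounds
  add up to `N Φ` and not `N² Φ`), and `Y ≤ 2(log H + log N)`, `a ≤ 2(log log H + log N)`,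
  `2a ≥ log log H + log₊ log N`.
* `Waldschmidt1978_cor_3_9_of_approx` — hence the named fact from Theorem 3.8 in this
  existential shape for every `e^β`, `β ≠ 0` algebraic (the remaining, deep, layer; not in this part).

## Part V (appended): the approximation measure for `e^β` and Corollary 3.9

* `Waldschmidt1978.approx_measure_exp_alg` — **the approximation measure of the shape of
  Theorem 3.8** for `e^β`, `β ≠ 0` algebraic: some `C₀ = C₀(β) ≥ 0` with
  `|e^β − ξ| ≥ exp{−C₀ n² Y (log Y + log n)²/(log Y)²}` for every root `ξ` of every irreducible
  `Q ∈ ℤ[X]` of degree `n ≥ 1` and every `Y ≥ max(log 16, log M(Q))`. The printed source deduces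
  Theorem 3.8 from the lower bound for `|β − log α|` of [W] ("Theorem A", p. 451, = Waldschmidt,
  Acta Arith. 37 (1980), not in the tree); we prove it instead by the interpolation-determinant
  method of [NesterenkoWaldschmidt1996] (their Theorem 1 with `θ = β`, `α = ξ`; the introduction
  there, after Theorem 1, lists `e^β` among the numbers so measured), generalised from the tree's
  `ExpOne…` files (`θ = 1`) to `θ = β`: the sibling files `…Matrix` (the functions `z^τ e^{tβz}`,
  Lemma 6 for `β`), `…Liouville` (the bivariate Liouville inequality in `F = ℚ(β, ξ)` through the absolute
  logarithmic Weil height `weilHeight₁`), `…Core` (`approx_core`: the contradiction for abstract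
  parameters) and `…Params` (the explicit parameters `T₁ = 100DΛ`, `S₁ = 2500DΛ`,
  `T = 250000gDVΛ`, `S = 130000gDVΛ`, `E = Y`, with `D = [ℚ(β):ℚ]·n`, `V = ⌈Y/log Y⌉`,
  `Λ = ⌈1 + (log D + κ)/log Y⌉`, and the verification of the main inequality, the zero-estimate
  counts and the smallness of the perturbation). Here these are instantiated in the field
  `F = ℚ(β) ⊔ ℚ(ξ)` (`[F:ℚ] ≤ [ℚ(β):ℚ]·n`, `[F:ℚ]·h(ξ) ≤ [ℚ(β):ℚ]·log M(Q)` by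
  `RoyWaldschmidt1997.MahlerWeil.weilHeight₁_root_le`, `[F:ℚ]·h(β) ≤ [ℚ(β):ℚ]·n·C_h(β)` by
  `exists_weilHeight₁_le_of_isAlgebraic`).
* `Waldschmidt1978_cor_3_9_holds` — the named fact, from `Waldschmidt1978_cor_3_9_of_approx`
  and `approx_measure_exp_alg`.

## References

* [Waldschmidt1978] M. Waldschmidt, J. Austral. Math. Soc. (A) 25 (1978) 445–465: Lemma 2.3
  (pp. 449–450), Theorem 3.8 and Corollary 3.9 (pp. 454–455).
* [NesterenkoWaldschmidt1996] Yu. V. Nesterenko, M. Waldschmidt, Mat. Zapiski 2 (1996) 23–42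
  (arXiv:math/0002047), §1 Lemma 1 (Fel'dman's transference).
* [Bugeaud2004] Y. Bugeaud, *Approximation by Algebraic Numbers*, CUP 2004, Lemma A.8.
-/

noncomputable section

open Polynomial Finset Complex

namespace Literature.NumberTheory.Transcendental

namespace Waldschmidt1978

open NesterenkoWaldschmidt1996 Literature.NumberTheory.DiophantineApproximation

/-! ### Numerical constants -/

/-- `1 < log 16` (indeed `log 16 = 4 log 2 > 2.77`). [folklore] -/
theorem one_lt_log_sixteen : 1 < Real.log 16 := by
  have h : Real.log 16 = 4 * Real.log 2 := by
    rw [show (16 : ℝ) = 2 ^ 4 by norm_num, Real.log_pow]; norm_num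
  rw [h]; have := Real.log_two_gt_d9; linarith

/-- `1 < log (log H)` for `H ≥ 16` (`exp 1 = 2.71828… < 2.77258… = 4 log 2 = log 16`; cf.
`Literature.NumberTheory.LFunctions.Tao2016.exp_one_lt_log_sixteen`, not imported here). [folklore] -/
theorem one_lt_log_log {H : ℝ} (hH : 16 ≤ H) : 1 < Real.log (Real.log H) := by
  have h16 : Real.log 16 ≤ Real.log H := Real.log_le_log (by norm_num) hH
  have he : Real.exp 1 < Real.log 16 := by
    have h : Real.log 16 = 4 * Real.log 2 := by
      rw [show (16 : ℝ) = 2 ^ 4 by norm_num, Real.log_pow]; norm_num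
    rw [h]
    have h1 := Real.log_two_gt_d9
    have h2 := Real.exp_one_lt_d9
    linarith
  have h1 : Real.exp 1 < Real.log H := he.trans_le h16
  have := Real.log_lt_log (Real.exp_pos 1) h1
  rwa [Real.log_exp] at this

/-! ### Lemma 2.3 with the Mahler measure: one irreducible factor -/

/-- **Lemma 2.3, one irreducible factor (Mahler-measure form).** Let `ω ∈ ℂ`, `Φ ≥ 0`, `Y`, `N`
be given, and assume that every irreducible `Q ∈ ℤ[X]` of degree `n`, `1 ≤ n ≤ N`, with
`log M(Q) ≤ Y` has all its complex roots `ξ` at distance `|ω − ξ| ≥ exp(−n Φ)`. If `P ≠ 0`,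
`deg P ≤ N`, `log M(P) ≤ Y` and `Q` is an irreducible factor of `P` of degree `n ≥ 1`, then
`|Q(ω)| ≥ exp{−n (Φ + log 2 + ½ log N + Y)}`: indeed `M(Q) ≤ M(P) ≤ e^Y`, and for the root `α`
of `Q` nearest to `ω` Bugeaud's Lemma A.8 (`ℓ = 1`) gives
`|ω − α| ≤ 2ⁿ n^{n/2} M(Q)ⁿ |Q(ω)| ≤ (2 √N e^Y)ⁿ |Q(ω)|` when `|Q(ω)| ≤ 1`.
[cite: Waldschmidt1978, Lemma 2.3 (proof, p. 450)] -/
theorem factor_lower_bound_mahler (ω : ℂ) {Φ Y : ℝ} (hΦ : 0 ≤ Φ) {N : ℕ}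
    (happrox : ∀ Q : ℤ[X], Irreducible Q → 0 < Q.natDegree → Q.natDegree ≤ N →
      Real.log (Q.map (Int.castRingHom ℂ)).mahlerMeasure ≤ Y → ∀ ξ : ℂ, aeval ξ Q = 0 →
      Real.exp (-(Q.natDegree * Φ)) ≤ ‖ω - ξ‖)
    {P : ℤ[X]} (hP : P ≠ 0) (hdeg : P.natDegree ≤ N)
    (hM : Real.log (P.map (Int.castRingHom ℂ)).mahlerMeasure ≤ Y)
    {Q : ℤ[X]} (hQ : Irreducible Q) (hn : 0 < Q.natDegree) (hQP : Q ∣ P) :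
    Real.exp (-(Q.natDegree * (Φ + Real.log 2 + Real.log N / 2 + Y))) ≤ ‖aeval ω Q‖ := by
  set n := Q.natDegree with hndef
  set q := Q.map (Int.castRingHom ℂ) with hq
  have hinj : Function.Injective (Int.castRingHom ℂ) := Int.cast_injective
  have hQ0 : Q ≠ 0 := hQ.ne_zero
  have hq0 : q ≠ 0 := (Polynomial.map_ne_zero_iff hinj).mpr hQ0
  have hnq : q.natDegree = n := natDegree_map_eq_of_injective hinj Q
  have hnN : n ≤ N := (natDegree_le_of_dvd hQP hP).trans hdeg
  have hN1 : 1 ≤ N := hn.trans_le hnN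
  have hNr : (1 : ℝ) ≤ N := by exact_mod_cast hN1
  have hN0 : (0 : ℝ) < N := by linarith
  have hn0 : (0 : ℝ) ≤ n := Nat.cast_nonneg _
  -- Mahler measures: `1 ≤ M(Q) ≤ M(P) ≤ e^Y`
  have hMQ1 : 1 ≤ q.mahlerMeasure := one_le_mahlerMeasure_of_ne_zero hQ0
  have hMQ0 : 0 < q.mahlerMeasure := one_pos.trans_le hMQ1
  have hMP1 : 1 ≤ (P.map (Int.castRingHom ℂ)).mahlerMeasure := one_le_mahlerMeasure_of_ne_zero hP
  have hMQP : q.mahlerMeasure ≤ (P.map (Int.castRingHom ℂ)).mahlerMeasure := mahlerMeasure_le_of_dvd hP hQP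
  have hlogMQ : Real.log q.mahlerMeasure ≤ Y := (Real.log_le_log hMQ0 hMQP).trans hM
  have hMQY : q.mahlerMeasure ≤ Real.exp Y := by
    calc q.mahlerMeasure = Real.exp (Real.log q.mahlerMeasure) := (Real.exp_log hMQ0).symm
      _ ≤ Real.exp Y := Real.exp_le_exp.mpr hlogMQ
  -- a root `α` of `q` nearest to `ω`
  have hsep : q.Separable := separable_map_of_irreducible hQ hn
  have hsplit : q.Splits := IsAlgClosed.splits q
  have hcard : q.roots.card = n := by rw [← hnq]; exact (hsplit.natDegree_eq_card_roots).symm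
  have hne : q.roots.toFinset.Nonempty := by
    rw [Multiset.toFinset_nonempty, ne_eq, ← Multiset.card_eq_zero, hcard]; omega
  obtain ⟨α, hαmem, hmin⟩ := q.roots.toFinset.exists_min_image (fun β => ‖ω - β‖) hne
  rw [Multiset.mem_toFinset] at hαmem
  have hmin' : ∀ β ∈ q.roots, ‖ω - α‖ ≤ ‖ω - β‖ := fun β hβ => hmin β (Multiset.mem_toFinset.mpr hβ)
  have hαroot : aeval α Q = 0 := by
    have h := (mem_roots hq0).mp hαmem
    rw [IsRoot.def] at h
    rw [aeval_def, algebraMap_int_eq, ← eval_map]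
    exact h
  -- the approximation hypothesis at `ξ = α`
  have hexp1 : Real.exp (-(n * Φ)) ≤ ‖ω - α‖ := happrox Q hQ hn hnN hlogMQ α hαroot
  -- the junk factor `J = exp(log 2 + ½ log N + Y)` with `J² = 4 N e^{2Y}`
  set K : ℝ := Real.log 2 + Real.log N / 2 + Y with hK
  have hK0 : 0 ≤ K := by
    have h1 : 0 ≤ Real.log (2 : ℝ) := Real.log_nonneg (by norm_num)
    have h2 : 0 ≤ Real.log (N : ℝ) := Real.log_natCast_nonneg N
    have h3 : 0 ≤ Y := (Real.log_nonneg hMP1).trans hM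
    rw [hK]; positivity
  have hJsq : Real.exp (2 * K) = 4 * N * Real.exp Y ^ 2 := by
    have e1 : 2 * K = Real.log 4 + Real.log N + 2 * Y := by
      rw [hK, show (4 : ℝ) = 2 ^ 2 by norm_num, Real.log_pow]; push_cast; ring
    rw [e1, Real.exp_add, Real.exp_add, Real.exp_log (by norm_num), Real.exp_log hN0,
      show (2 : ℝ) * Y = (2 : ℕ) * Y by norm_num, Real.exp_nat_mul]
  by_cases hsmall : ‖aeval ω Q‖ ≤ 1
  swap
  · push Not at hsmall
    refine le_trans ?_ hsmall.le
    rw [Real.exp_le_one_iff]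
    have : 0 ≤ (n : ℝ) * (Φ + K) := by positivity
    rw [hK] at this
    linarith
  -- Bugeaud's Lemma A.8 with `ℓ = 1`: `|ω − α|² ≤ 2^{2n} nⁿ M^{2n} |Q(ω)|² ≤ (4 N e^{2Y})ⁿ |Q(ω)|²`
  have A8 := norm_sub_root_pow_le Q hn hsep ω α hαmem hmin' hsmall 1 le_rfl
  have A8' : ‖ω - α‖ ^ 2 ≤ Real.exp (2 * K) ^ n * ‖aeval ω Q‖ ^ 2 := by
    have e1 : (1 * (1 + 1) : ℕ) = 2 := rfl
    rw [e1, mul_one, ← hq, ← hndef] at A8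
    refine A8.trans (mul_le_mul_of_nonneg_right ?_ (by positivity))
    rw [hJsq, mul_pow, mul_pow, ← pow_mul]
    have hnn : (n : ℝ) ^ n ≤ (N : ℝ) ^ n :=
      pow_le_pow_left₀ (Nat.cast_nonneg _) (by exact_mod_cast hnN) n
    have hMM : q.mahlerMeasure ^ (2 * n) ≤ Real.exp Y ^ (2 * n) :=
      pow_le_pow_left₀ hMQ0.le hMQY _
    have h4 : (2 : ℝ) ^ (2 * n) = 4 ^ n := by rw [pow_mul]; norm_num
    rw [h4]
    gcongr
  -- conclude by comparing squares
  have hsq : (Real.exp (-(n * (Φ + K)))) ^ 2 ≤ ‖aeval ω Q‖ ^ 2 := by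
    have h1 : (Real.exp (-(n * Φ))) ^ 2 ≤ Real.exp (2 * K) ^ n * ‖aeval ω Q‖ ^ 2 :=
      (pow_le_pow_left₀ (Real.exp_nonneg _) hexp1 2).trans A8'
    have e2 : (Real.exp (-(n * (Φ + K)))) ^ 2 * Real.exp (2 * K) ^ n = (Real.exp (-(n * Φ))) ^ 2 := by
      rw [← Real.exp_nat_mul, ← Real.exp_nat_mul, ← Real.exp_nat_mul, ← Real.exp_add]
      push_cast; ring_nf
    rw [← e2, mul_comm (Real.exp (2 * K) ^ n)] at h1
    exact le_of_mul_le_mul_right h1 (pow_pos (Real.exp_pos _) _)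
  have := (pow_le_pow_iff_left₀ (Real.exp_nonneg _) (norm_nonneg _) two_ne_zero).mp hsq
  have e3 : Φ + Real.log 2 + Real.log N / 2 + Y = Φ + K := by rw [hK]; ring
  rw [e3]; exact this

/-! ### Lemma 2.3 with the Mahler measure: all non-zero `P` -/

/-- **Lemma 2.3 (Mahler-measure form of Fel'dman's transference).** Let `ω ∈ ℂ`, `Φ ≥ 0`, `Y`,
`N` be given, and assume that every irreducible `Q ∈ ℤ[X]` of degree `n`, `1 ≤ n ≤ N`, with
`log M(Q) ≤ Y` has all its complex roots `ξ` at distance `|ω − ξ| ≥ exp(−n Φ)`. Then every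
non-zero `P ∈ ℤ[X]` with `deg P ≤ N` and `log M(P) ≤ Y` satisfies
`|P(ω)| ≥ exp{−deg P · (Φ + log 2 + ½ log N + Y)}` (factor `P` into irreducibles in the UFD
`ℤ[X]`: degrees add, Mahler measures of factors are `≤ M(P)`, constants have modulus `≥ 1`).
[cite: Waldschmidt1978, Lemma 2.3] -/
theorem transference_mahler (ω : ℂ) {Φ Y : ℝ} (hΦ : 0 ≤ Φ) {N : ℕ}
    (happrox : ∀ Q : ℤ[X], Irreducible Q → 0 < Q.natDegree → Q.natDegree ≤ N →
      Real.log (Q.map (Int.castRingHom ℂ)).mahlerMeasure ≤ Y → ∀ ξ : ℂ, aeval ξ Q = 0 →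
      Real.exp (-(Q.natDegree * Φ)) ≤ ‖ω - ξ‖)
    {P : ℤ[X]} (hP : P ≠ 0) (hdeg : P.natDegree ≤ N)
    (hM : Real.log (P.map (Int.castRingHom ℂ)).mahlerMeasure ≤ Y) :
    Real.exp (-(P.natDegree * (Φ + Real.log 2 + Real.log N / 2 + Y))) ≤ ‖aeval ω P‖ := by
  set K := Φ + Real.log 2 + Real.log N / 2 + Y with hK
  have hMP1 : 1 ≤ (P.map (Int.castRingHom ℂ)).mahlerMeasure := one_le_mahlerMeasure_of_ne_zero hP
  have hK0 : 0 ≤ K := by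
    have h1 : 0 ≤ Real.log (2 : ℝ) := Real.log_nonneg (by norm_num)
    have h2 : 0 ≤ Real.log (N : ℝ) := Real.log_natCast_nonneg N
    have h3 : 0 ≤ Y := (Real.log_nonneg hMP1).trans hM
    rw [hK]; positivity
  suffices H : ∀ R : ℤ[X], R ∣ P → Real.exp (-(R.natDegree * K)) ≤ ‖aeval ω R‖ from H P dvd_rfl
  intro R
  induction R using WfDvdMonoid.induction_on_irreducible with
  | zero => intro h; exact absurd (zero_dvd_iff.mp h) hP
  | unit u hu =>
    intro _
    obtain ⟨r, hr, rfl⟩ := Polynomial.isUnit_iff.mp hu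
    rw [natDegree_C, aeval_C, algebraMap_int_eq, eq_intCast, Complex.norm_intCast]
    rcases Int.isUnit_iff.mp hr with h | h <;> simp [h]
  | mul a i ha hi IH =>
    intro hdvd
    have hadvd : a ∣ P := dvd_trans (dvd_mul_left a i) hdvd
    have hidvd : i ∣ P := dvd_trans (dvd_mul_right i a) hdvd
    rw [natDegree_mul hi.ne_zero ha, map_mul, norm_mul, Nat.cast_add, add_mul, neg_add,
      Real.exp_add]
    refine mul_le_mul ?_ (IH hadvd) (Real.exp_nonneg _) (norm_nonneg _)
    rcases Nat.eq_zero_or_pos i.natDegree with h0 | hpos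
    · -- `i` is a non-zero constant: `|i(ω)| ≥ 1`
      rw [h0, Nat.cast_zero, zero_mul, neg_zero, Real.exp_zero]
      have hc : i.coeff 0 ≠ 0 := by
        intro h
        apply hi.ne_zero
        rw [eq_C_of_natDegree_eq_zero h0, h, C_0]
      rw [eq_C_of_natDegree_eq_zero h0, aeval_C, algebraMap_int_eq, eq_intCast, Complex.norm_intCast]
      exact_mod_cast Int.one_le_abs hc
    · exact factor_lower_bound_mahler ω hΦ happrox hP hdeg hM hi hpos hidvd

/-! ### The height of `P`: `M(P) ≤ L(P) ≤ (N + 1) H` -/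

/-- `log M(P) ≤ log((N+1) H)` for `P ≠ 0` of degree `≤ N` and usual height `≤ H`
(`M(P) ≤ L(P) = Σ |aₖ| ≤ (N+1) H`). [folklore] -/
theorem log_mahlerMeasure_le {P : ℤ[X]} (hP : P ≠ 0) {N H : ℕ} (hdeg : P.natDegree ≤ N)
    (hcoeff : ∀ k, |P.coeff k| ≤ (H : ℤ)) :
    Real.log (P.map (Int.castRingHom ℂ)).mahlerMeasure ≤ Real.log (((N : ℝ) + 1) * H) := by
  have hMP1 : 1 ≤ (P.map (Int.castRingHom ℂ)).mahlerMeasure := one_le_mahlerMeasure_of_ne_zero hP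
  refine Real.log_le_log (one_pos.trans_le hMP1) ?_
  refine (mahlerMeasure_le_length P).trans ?_
  have h1 : (∑ k ∈ Finset.range (P.natDegree + 1), |P.coeff k|) ≤
      ∑ _k ∈ Finset.range (P.natDegree + 1), (H : ℤ) := Finset.sum_le_sum fun k _ => hcoeff k
  rw [Finset.sum_const, Finset.card_range, nsmul_eq_mul] at h1
  have h2 : ((P.natDegree + 1 : ℕ) : ℤ) * H ≤ ((N + 1 : ℕ) : ℤ) * H := by
    have : ((P.natDegree + 1 : ℕ) : ℤ) ≤ ((N + 1 : ℕ) : ℤ) := by exact_mod_cast Nat.succ_le_succ hdeg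
    exact mul_le_mul_of_nonneg_right this (by positivity)
  have h3 : ((∑ k ∈ Finset.range (P.natDegree + 1), |P.coeff k| : ℤ) : ℝ) ≤ (((N + 1 : ℕ) : ℤ) * H : ℤ) := by
    exact_mod_cast h1.trans h2
  refine h3.trans (le_of_eq ?_)
  push_cast; ring

/-! ### Corollary 3.9 from an approximation measure of the shape of Theorem 3.8 -/

/-- **The numerical heart of Corollary 3.9 (p. 455).** For `N ≥ 1`, `H ≥ 16`, `Y = log((N+1)H)`
and `a = log Y`: `Y ≥ log 16`, `a ≥ 1`, `Y ≤ 2(log H + log N)`,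
`(a + log N)² ≤ 4 (log log H + log N)²`, `(log log H + log₊ log N)² ≤ 4 a²`, and
`log₊ log N ≤ log N` — so that
`N · (C₀ N Y (a + log N)²/a² + log 2 + ½ log N + Y) ≤ (32 C₀ + 3) N² (log H + log N)(log log H + log N)²/(log log H + log₊ log N)²`.
[cite: Waldschmidt1978, Corollary 3.9 (proof, p. 455)] -/
theorem numerics_cor_3_9 {C₀ : ℝ} (hC₀ : 0 ≤ C₀) {N H : ℕ} (hN : 1 ≤ N) (hH : 16 ≤ H) :
    let Y : ℝ := Real.log (((N : ℝ) + 1) * H)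
    Real.log 16 ≤ Y ∧ 1 ≤ Real.log Y ∧
    (N : ℝ) * (C₀ * N * Y * (Real.log Y + Real.log N) ^ 2 / Real.log Y ^ 2 +
        Real.log 2 + Real.log N / 2 + Y) ≤
      (32 * C₀ + 3) * (N : ℝ) ^ 2 * (Real.log H + Real.log N) *
        (Real.log (Real.log H) + Real.log N) ^ 2 /
        (Real.log (Real.log H) + Real.log (max 1 (Real.log N))) ^ 2 := by
  intro Y
  have hNr : (1 : ℝ) ≤ N := by exact_mod_cast hN
  have hN0 : (0 : ℝ) < N := by linarith
  have hHr : (16 : ℝ) ≤ H := by exact_mod_cast hH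
  have hH0 : (0 : ℝ) < H := by linarith
  -- logarithms of the data
  set lH := Real.log (H : ℝ) with hlH
  set lN := Real.log (N : ℝ) with hlN
  set llH := Real.log lH with hllH
  set lpN := Real.log (max 1 lN) with hlpN
  have hlH16 : Real.log 16 ≤ lH := Real.log_le_log (by norm_num) hHr
  have hlH1 : 1 ≤ lH := one_lt_log_sixteen.le.trans hlH16
  have hlN0 : 0 ≤ lN := Real.log_nonneg hNr
  have hllH1 : 1 ≤ llH := (one_lt_log_log hHr).le
  have hlpN0 : 0 ≤ lpN := Real.log_nonneg (le_max_left _ _)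
  have hl2 : Real.log 2 < 1 := by have := Real.log_two_lt_d9; linarith
  have hl20 : 0 < Real.log 2 := Real.log_pos (by norm_num)
  -- `Y = log H + log (N+1)`, `log N ≤ log (N+1) ≤ log 2 + log N`
  have hYeq : Y = lH + Real.log ((N : ℝ) + 1) := by
    show Real.log (((N : ℝ) + 1) * H) = _
    rw [Real.log_mul (by positivity) hH0.ne']; ring
  have hlN1lo : lN ≤ Real.log ((N : ℝ) + 1) := Real.log_le_log hN0 (by linarith)
  have hlN1hi : Real.log ((N : ℝ) + 1) ≤ Real.log 2 + lN := by
    rw [hlN, ← Real.log_mul (by norm_num) hN0.ne']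
    exact Real.log_le_log (by positivity) (by linarith)
  have hlN10 : 0 ≤ Real.log ((N : ℝ) + 1) := hlN0.trans hlN1lo
  -- (1) `Y ≥ log 16`, indeed `Y ≥ lH ≥ log 16 > e`, so `a = log Y ≥ 1`
  have hYlH : lH ≤ Y := by rw [hYeq]; linarith
  have hY16 : Real.log 16 ≤ Y := hlH16.trans hYlH
  have hY0 : 0 < Y := by linarith
  set a := Real.log Y with ha
  have hallH : llH ≤ a := Real.log_le_log (by linarith) hYlH
  have ha1 : 1 ≤ a := hllH1.trans hallH
  have ha0 : 0 < a := by linarith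
  refine ⟨hY16, ha1, ?_⟩
  -- (2) `Y ≤ 2 (lH + lN)`
  have hY2 : Y ≤ 2 * (lH + lN) := by rw [hYeq]; linarith
  -- (3) `a ≤ 2 llH + lN`: `Y ≤ lH (1 + log(N+1))`, `log(1 + log(N+1)) ≤ log(N+1) ≤ log 2 + lN`
  have ha2 : a ≤ 2 * llH + lN := by
    have h1 : Y ≤ lH * (1 + Real.log ((N : ℝ) + 1)) := by
      rw [hYeq]
      have : Real.log ((N : ℝ) + 1) ≤ lH * Real.log ((N : ℝ) + 1) :=
        le_mul_of_one_le_left hlN10 hlH1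
      linarith
    have h2 : a ≤ llH + Real.log (1 + Real.log ((N : ℝ) + 1)) := by
      rw [ha, hllH, ← Real.log_mul (by linarith) (by linarith)]
      exact Real.log_le_log hY0 h1
    have h3 : Real.log (1 + Real.log ((N : ℝ) + 1)) ≤ Real.log ((N : ℝ) + 1) := by
      have h4 : 1 + Real.log ((N : ℝ) + 1) ≤ (N : ℝ) + 1 := by
        have := Real.add_one_le_exp (Real.log ((N : ℝ) + 1))
        rw [Real.exp_log (by linarith)] at this; linarith
      exact Real.log_le_log (by linarith) h4
    linarith
  -- (4) `llH + lpN ≤ 2a` and `lpN ≤ lN`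
  have hlpN : lpN ≤ a ∧ lpN ≤ lN := by
    rcases le_or_gt lN 1 with hle | hgt
    · have : lpN = 0 := by rw [hlpN, max_eq_left hle, Real.log_one]
      rw [this]; exact ⟨ha0.le, hlN0⟩
    · have hmax : max 1 lN = lN := max_eq_right hgt.le
      rw [hlpN, hmax]
      constructor
      · refine Real.log_le_log (by linarith) ?_
        calc lN ≤ Real.log ((N : ℝ) + 1) := hlN1lo
          _ ≤ Y := by rw [hYeq]; linarith
      · have := Real.log_le_sub_one_of_pos (by linarith : 0 < lN); linarith
  obtain ⟨hlpNa, hlpNlN⟩ := hlpN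
  have hden0 : 0 < llH + lpN := by linarith
  have hden : (llH + lpN) ^ 2 ≤ 4 * a ^ 2 := by nlinarith
  -- the target quantity `T` and the comparison
  set T := (N : ℝ) ^ 2 * (lH + lN) * (llH + lN) ^ 2 / (llH + lpN) ^ 2 with hT
  have hratio : 1 ≤ (llH + lN) ^ 2 / (llH + lpN) ^ 2 := by
    rw [one_le_div (by positivity)]
    exact pow_le_pow_left₀ hden0.le (by linarith) 2
  have hT1 : (N : ℝ) ^ 2 * (lH + lN) ≤ T := by
    rw [hT, mul_div_assoc]
    exact le_mul_of_one_le_right (by positivity) hratio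
  -- main term: `N · C₀ N Y (a + lN)²/a² ≤ 32 C₀ T`
  have hmainT : (N : ℝ) * (C₀ * N * Y * (a + lN) ^ 2 / a ^ 2) ≤ 32 * C₀ * T := by
    have h1 : (a + lN) ^ 2 ≤ 4 * (llH + lN) ^ 2 := by
      have h0 : a + lN ≤ 2 * (llH + lN) := by linarith
      calc (a + lN) ^ 2 ≤ (2 * (llH + lN)) ^ 2 := pow_le_pow_left₀ (by positivity) h0 2
        _ = 4 * (llH + lN) ^ 2 := by ring
    have h2 : (a + lN) ^ 2 / a ^ 2 ≤ 16 * ((llH + lN) ^ 2 / (llH + lpN) ^ 2) := by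
      rw [div_le_iff₀ (by positivity)]
      calc (a + lN) ^ 2 ≤ 4 * (llH + lN) ^ 2 := h1
        _ = 4 * (llH + lN) ^ 2 / (llH + lpN) ^ 2 * (llH + lpN) ^ 2 := by
            field_simp
        _ ≤ 4 * (llH + lN) ^ 2 / (llH + lpN) ^ 2 * (4 * a ^ 2) := by gcongr
        _ = 16 * ((llH + lN) ^ 2 / (llH + lpN) ^ 2) * a ^ 2 := by ring
    calc (N : ℝ) * (C₀ * N * Y * (a + lN) ^ 2 / a ^ 2)
        = C₀ * (N : ℝ) ^ 2 * Y * ((a + lN) ^ 2 / a ^ 2) := by ring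
      _ ≤ C₀ * (N : ℝ) ^ 2 * (2 * (lH + lN)) * (16 * ((llH + lN) ^ 2 / (llH + lpN) ^ 2)) := by
          gcongr
      _ = 32 * C₀ * T := by rw [hT]; ring
  -- junk term: `N (log 2 + lN/2 + Y) ≤ 3 N² (lH + lN) ≤ 3 T`
  have hjunk : (N : ℝ) * (Real.log 2 + lN / 2 + Y) ≤ 3 * T := by
    have h1 : Real.log 2 + lN / 2 + Y ≤ 3 * (lH + lN) := by linarith
    have hNN : (N : ℝ) ≤ (N : ℝ) ^ 2 := by nlinarith
    calc (N : ℝ) * (Real.log 2 + lN / 2 + Y) ≤ N * (3 * (lH + lN)) :=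
          mul_le_mul_of_nonneg_left h1 hN0.le
      _ ≤ (N : ℝ) ^ 2 * (3 * (lH + lN)) := mul_le_mul_of_nonneg_right hNN (by positivity)
      _ = 3 * ((N : ℝ) ^ 2 * (lH + lN)) := by ring
      _ ≤ 3 * T := by linarith
  calc (N : ℝ) * (C₀ * N * Y * (a + lN) ^ 2 / a ^ 2 + Real.log 2 + lN / 2 + Y)
      = (N : ℝ) * (C₀ * N * Y * (a + lN) ^ 2 / a ^ 2) + N * (Real.log 2 + lN / 2 + Y) := by ring
    _ ≤ 32 * C₀ * T + 3 * T := add_le_add hmainT hjunk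
    _ = (32 * C₀ + 3) * (N : ℝ) ^ 2 * (lH + lN) * (llH + lN) ^ 2 / (llH + lpN) ^ 2 := by
        rw [hT]; ring

/-- **Corollary 3.9 for `ω` from an approximation measure of the shape of Theorem 3.8 for `ω`.**
Let `ω ∈ ℂ` and `C₀ ≥ 0` be such that every complex root `ξ` of every irreducible `Q ∈ ℤ[X]`
of degree `n ≥ 1` satisfies `|ω − ξ| ≥ exp{−C₀ n² Y (log Y + log n)²/(log Y)²}` for every real
`Y ≥ max(log 16, log M(Q))` (`M` the Mahler measure; this is the approximation measure
`C₁₆ N²(Log M)(Log Log M + Log N)²(Log Log M)⁻²` of Theorem 3.8 with an unspecified constant).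
Then for every non-zero `P ∈ ℤ[X]` of degree `≤ N` (`N ≥ 1`) and usual height `≤ H` (`H ≥ 16`),
`|P(ω)| ≥ exp{−C N² (log H + log N)(log log H + log N)²(log log H + log₊ log N)⁻²}` with
`C = 32 C₀ + 3`. Proof: Lemma 2.3 (`transference_mahler`) with `Y = log((N+1)H) ≥ log M(P)`,
`Φ = C₀ N Y (log Y + log N)²/(log Y)²` (for a factor of degree `n ≤ N` the hypothesis gives
`exp(−n Φ)`), and `numerics_cor_3_9`. [cite: Waldschmidt1978, Corollary 3.9] -/
theorem cor_3_9_of_approx (ω : ℂ) {C₀ : ℝ} (hC₀ : 0 ≤ C₀)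
    (hAM : ∀ Q : ℤ[X], Irreducible Q → 0 < Q.natDegree → ∀ ξ : ℂ, aeval ξ Q = 0 → ∀ Y : ℝ,
      Real.log 16 ≤ Y → Real.log (Q.map (Int.castRingHom ℂ)).mahlerMeasure ≤ Y →
      Real.exp (-(C₀ * (Q.natDegree : ℝ) ^ 2 * Y * (Real.log Y + Real.log Q.natDegree) ^ 2 /
        Real.log Y ^ 2)) ≤ ‖ω - ξ‖) :
    ∃ C : ℝ, 0 < C ∧ ∀ (P : Polynomial ℤ) (N H : ℕ), P ≠ 0 → 1 ≤ N → P.natDegree ≤ N → 16 ≤ H →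
      (∀ k, |P.coeff k| ≤ (H : ℤ)) →
      Real.exp (-(C * (N : ℝ) ^ 2 * (Real.log H + Real.log N) *
          (Real.log (Real.log H) + Real.log N) ^ 2 /
          (Real.log (Real.log H) + Real.log (max 1 (Real.log N))) ^ 2)) ≤
        ‖Polynomial.aeval ω P‖ := by
  refine ⟨32 * C₀ + 3, by positivity, ?_⟩
  intro P N H hP hN hdeg hH hcoeff
  obtain ⟨hY16, ha1, hnum⟩ := numerics_cor_3_9 hC₀ hN hH
  set Y : ℝ := Real.log (((N : ℝ) + 1) * H) with hY
  set a := Real.log Y with ha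
  have hNr : (1 : ℝ) ≤ N := by exact_mod_cast hN
  have hN0 : (0 : ℝ) < N := by linarith
  have ha0 : 0 < a := by linarith
  have hY0 : 0 < Y := by linarith [one_lt_log_sixteen]
  have hlN0 : 0 ≤ Real.log (N : ℝ) := Real.log_nonneg hNr
  set Φ : ℝ := C₀ * N * Y * (a + Real.log N) ^ 2 / a ^ 2 with hΦ
  have hΦ0 : 0 ≤ Φ := by rw [hΦ]; positivity
  -- the hypothesis of the transference
  have happrox : ∀ Q : ℤ[X], Irreducible Q → 0 < Q.natDegree → Q.natDegree ≤ N →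
      Real.log (Q.map (Int.castRingHom ℂ)).mahlerMeasure ≤ Y → ∀ ξ : ℂ, aeval ξ Q = 0 →
      Real.exp (-(Q.natDegree * Φ)) ≤ ‖ω - ξ‖ := by
    intro Q hQ hn hnN hMQ ξ hξ
    refine le_trans (Real.exp_le_exp.mpr ?_) (hAM Q hQ hn ξ hξ Y hY16 hMQ)
    rw [neg_le_neg_iff, hΦ]
    set n := Q.natDegree
    have hn1 : (1 : ℝ) ≤ n := by exact_mod_cast hn
    have hnN' : (n : ℝ) ≤ N := by exact_mod_cast hnN
    have hln0 : 0 ≤ Real.log (n : ℝ) := Real.log_nonneg hn1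
    have hln : Real.log (n : ℝ) ≤ Real.log N := Real.log_le_log (by linarith) hnN'
    have h1 : (a + Real.log n) ^ 2 ≤ (a + Real.log N) ^ 2 := by nlinarith
    calc C₀ * (n : ℝ) ^ 2 * Y * (a + Real.log n) ^ 2 / a ^ 2
        = (n : ℝ) * (C₀ * n * Y * (a + Real.log n) ^ 2 / a ^ 2) := by ring
      _ ≤ (n : ℝ) * (C₀ * N * Y * (a + Real.log N) ^ 2 / a ^ 2) := by
          refine mul_le_mul_of_nonneg_left ?_ (by linarith)
          rw [div_le_div_iff_of_pos_right (by positivity)]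
          gcongr
  have hM : Real.log (P.map (Int.castRingHom ℂ)).mahlerMeasure ≤ Y := log_mahlerMeasure_le hP hdeg hcoeff
  have key := transference_mahler ω hΦ0 happrox hP hdeg hM
  refine le_trans (Real.exp_le_exp.mpr ?_) key
  rw [neg_le_neg_iff]
  have hdegr : (P.natDegree : ℝ) ≤ N := by exact_mod_cast hdeg
  have hK0 : 0 ≤ Φ + Real.log 2 + Real.log N / 2 + Y := by
    have : 0 ≤ Real.log (2 : ℝ) := Real.log_nonneg (by norm_num)
    positivity
  calc (P.natDegree : ℝ) * (Φ + Real.log 2 + Real.log N / 2 + Y)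
      ≤ N * (Φ + Real.log 2 + Real.log N / 2 + Y) := mul_le_mul_of_nonneg_right hdegr hK0
    _ = N * (C₀ * N * Y * (Real.log Y + Real.log N) ^ 2 / Real.log Y ^ 2 +
        Real.log 2 + Real.log N / 2 + Y) := by rw [hΦ]
    _ ≤ _ := hnum

end Waldschmidt1978

/-- **Waldschmidt 1978, Corollary 3.9 from Theorem 3.8 (existential constants).** If every
`e^β`, `β ≠ 0` algebraic, admits an approximation measure of the shape of Theorem 3.8 — some
`C₀ ≥ 0` with `|e^β − ξ| ≥ exp{−C₀ n² Y (log Y + log n)²/(log Y)²}` for every root `ξ` of every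
irreducible `Q ∈ ℤ[X]` of degree `n ≥ 1` and every `Y ≥ max(log 16, log M(Q))` — then the named
fact `Waldschmidt1978_cor_3_9` holds (Lemma 2.3, `Waldschmidt1978.cor_3_9_of_approx`).
[cite: Waldschmidt1978, Corollary 3.9] -/
theorem Waldschmidt1978_cor_3_9_of_approx
    (h38 : ∀ β : ℂ, IsAlgebraic ℚ β → β ≠ 0 → ∃ C₀ : ℝ, 0 ≤ C₀ ∧
      ∀ Q : ℤ[X], Irreducible Q → 0 < Q.natDegree → ∀ ξ : ℂ, aeval ξ Q = 0 → ∀ Y : ℝ,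
        Real.log 16 ≤ Y → Real.log (Q.map (Int.castRingHom ℂ)).mahlerMeasure ≤ Y →
        Real.exp (-(C₀ * (Q.natDegree : ℝ) ^ 2 * Y * (Real.log Y + Real.log Q.natDegree) ^ 2 /
          Real.log Y ^ 2)) ≤ ‖Complex.exp β - ξ‖) :
    Waldschmidt1978_cor_3_9 := by
  intro β hβ hβ0
  obtain ⟨C₀, hC₀, hAM⟩ := h38 β hβ hβ0
  exact Waldschmidt1978.cor_3_9_of_approx (Complex.exp β) hC₀ hAM

namespace Waldschmidt1978

/-! ## Part V: the approximation measure for `e^β` and the discharge of the named fact -/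

/-- Choice of the scaling parameter `Λ = ⌈1 + (log D + κ)/a⌉`: `1 ≤ Λ`, `log D + κ ≤ a(Λ − 1)`
and `aΛ ≤ 2(a + log D + κ)`. [folklore] -/
theorem exists_Lambda {a D κ : ℝ} (ha : 1 ≤ a) (hD : 1 ≤ D) (hκ : 0 ≤ κ) :
    ∃ Λ : ℕ, (1 : ℝ) ≤ Λ ∧ Real.log D + κ ≤ a * ((Λ : ℝ) - 1) ∧
      a * Λ ≤ 2 * (a + Real.log D + κ) := by
  have ha0 : 0 < a := by linarith
  have hlogD : 0 ≤ Real.log D := Real.log_nonneg hD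
  have hq : 0 ≤ (Real.log D + κ) / a := div_nonneg (by linarith) ha0.le
  have hqa : a * ((Real.log D + κ) / a) = Real.log D + κ := mul_div_cancel₀ _ ha0.ne'
  have h1 : (1 : ℝ) + (Real.log D + κ) / a ≤ ⌈1 + (Real.log D + κ) / a⌉₊ := Nat.le_ceil _
  have h1' : ((⌈1 + (Real.log D + κ) / a⌉₊ : ℕ) : ℝ) < 1 + (Real.log D + κ) / a + 1 :=
    Nat.ceil_lt_add_one (by linarith)
  refine ⟨⌈1 + (Real.log D + κ) / a⌉₊, by linarith, ?_, ?_⟩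
  · have h2 : a * ((Real.log D + κ) / a) ≤ a * (((⌈1 + (Real.log D + κ) / a⌉₊ : ℕ) : ℝ) - 1) :=
      mul_le_mul_of_nonneg_left (by linarith) ha0.le
    linarith
  · have h2 : a * (((⌈1 + (Real.log D + κ) / a⌉₊ : ℕ) : ℝ)) ≤ a * (2 + (Real.log D + κ) / a) :=
      mul_le_mul_of_nonneg_left (by linarith) ha0.le
    have h3 : a * (2 + (Real.log D + κ) / a) = 2 * a + (Real.log D + κ) := by
      rw [mul_add, hqa]; ring
    linarith

/-- Choice of `V = ⌈Y / log Y⌉` (`Y ≥ log 16`): `1 ≤ V`, `Y ≤ (log Y) V ≤ 2Y` and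
`log V ≤ 2 log Y`. [folklore] -/
theorem exists_V {Y : ℝ} (hY : Real.log 16 ≤ Y) :
    ∃ V : ℕ, (1 : ℝ) ≤ V ∧ Y ≤ Real.log Y * V ∧ Real.log Y * V ≤ 2 * Y ∧
      Real.log V ≤ 2 * Real.log Y := by
  have h16 := one_lt_log_sixteen
  have hY1 : 1 < Y := lt_of_lt_of_le h16 hY
  have hY0 : 0 < Y := by linarith
  have ha1 : 1 ≤ Real.log Y :=
    le_trans (one_lt_log_log (le_refl (16 : ℝ))).le (Real.log_le_log (by linarith) hY)
  have haY : Real.log Y ≤ Y := log_le_self_of_one_le hY1.le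
  set a := Real.log Y with ha
  have ha0 : 0 < a := by linarith
  have hq1 : 1 ≤ Y / a := by rw [le_div_iff₀ ha0]; linarith
  have hqa : a * (Y / a) = Y := mul_div_cancel₀ _ ha0.ne'
  have hc : Y / a ≤ ⌈Y / a⌉₊ := Nat.le_ceil _
  have hc' : ((⌈Y / a⌉₊ : ℕ) : ℝ) < Y / a + 1 := Nat.ceil_lt_add_one (by linarith)
  have hV1 : (1 : ℝ) ≤ ⌈Y / a⌉₊ := le_trans hq1 hc
  refine ⟨⌈Y / a⌉₊, hV1, ?_, ?_, ?_⟩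
  · have h2 := mul_le_mul_of_nonneg_left hc ha0.le
    linarith
  · have h2 : a * ((⌈Y / a⌉₊ : ℕ) : ℝ) ≤ a * (Y / a + Y / a) :=
      mul_le_mul_of_nonneg_left (by linarith) ha0.le
    rw [mul_add, hqa] at h2
    linarith
  · have h2 : ((⌈Y / a⌉₊ : ℕ) : ℝ) ≤ 2 * Y := by
      have : Y / a ≤ Y := div_le_self hY0.le ha1
      linarith
    have hlog2 : Real.log 2 ≤ 1 := by
      have := Real.log_le_sub_one_of_pos (show (0 : ℝ) < 2 by norm_num); linarith
    calc Real.log ((⌈Y / a⌉₊ : ℕ) : ℝ) ≤ Real.log (2 * Y) := Real.log_le_log (by linarith) h2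
      _ = Real.log 2 + a := by rw [Real.log_mul (by norm_num) hY0.ne', ha]
      _ ≤ 2 * a := by linarith

/-- The auxiliary bound `B = 2 max(|e^β|, |e^β|⁻¹)`: `|e^β|^{±1} ≤ B`, `0 ≤ log B ≤ ‖β‖ + 1`, and
every `ξ` with `|e^β − ξ| ≤ exp(−(‖β‖ + 2))` (`≤ |e^β|/2`) has `ξ ≠ 0` and `|ξ|^{±1} ≤ B`.
[folklore] -/
theorem exists_B (β : ℂ) : ∃ B : ℝ, 1 ≤ B ∧ ‖cexp β‖ ≤ B ∧ ‖cexp β‖⁻¹ ≤ B ∧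
    0 ≤ Real.log B ∧ Real.log B ≤ ‖β‖ + 1 ∧
    ∀ ξ : ℂ, ‖cexp β - ξ‖ ≤ Real.exp (-(‖β‖ + 2)) → ξ ≠ 0 ∧ ‖ξ‖ ≤ B ∧ ‖ξ‖⁻¹ ≤ B := by
  set w : ℂ := cexp β with hw
  have hwre : ‖w‖ = Real.exp β.re := Complex.norm_exp β
  have hw0 : 0 < ‖w‖ := by rw [hwre]; exact Real.exp_pos _
  set M₀ : ℝ := max ‖w‖ ‖w‖⁻¹ with hM₀
  have hM₀1 : 1 ≤ M₀ := by
    rcases le_total 1 ‖w‖ with h | h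
    · exact le_max_of_le_left h
    · exact le_max_of_le_right ((one_le_inv₀ hw0).mpr h)
  have hwM : ‖w‖ ≤ M₀ := le_max_left _ _
  have hwM' : ‖w‖⁻¹ ≤ M₀ := le_max_right _ _
  have hre := Complex.abs_re_le_norm β
  -- `M₀ ≤ exp ‖β‖`
  have hM₀e : M₀ ≤ Real.exp ‖β‖ := by
    refine max_le ?_ ?_
    · rw [hwre]; exact Real.exp_le_exp.mpr (le_trans (le_abs_self _) hre)
    · rw [hwre, ← Real.exp_neg]; exact Real.exp_le_exp.mpr (le_trans (neg_le_abs _) hre)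
  refine ⟨2 * M₀, by linarith, by linarith, by linarith, Real.log_nonneg (by linarith), ?_, ?_⟩
  · have hlog2 : Real.log 2 ≤ 1 := by
      have := Real.log_le_sub_one_of_pos (show (0 : ℝ) < 2 by norm_num); linarith
    calc Real.log (2 * M₀) ≤ Real.log (2 * Real.exp ‖β‖) :=
          Real.log_le_log (by linarith) (by linarith)
      _ = Real.log 2 + ‖β‖ := by
          rw [Real.log_mul (by norm_num) (Real.exp_pos _).ne', Real.log_exp]
      _ ≤ ‖β‖ + 1 := by linarith
  · intro ξ hξ
    -- `exp(−(‖β‖ + 2)) ≤ |w| / e ≤ |w| / 2`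
    have hδ : ‖w - ξ‖ ≤ ‖w‖ / 2 := by
      refine le_trans hξ ?_
      have h1 : Real.exp (-(‖β‖ + 2)) ≤ Real.exp (β.re - 1) :=
        Real.exp_le_exp.mpr (by linarith [neg_le_abs β.re])
      have h2 : Real.exp (β.re - 1) = ‖w‖ / Real.exp 1 := by rw [Real.exp_sub, hwre]
      have h3 : (2 : ℝ) ≤ Real.exp 1 := by have := Real.add_one_le_exp (1 : ℝ); linarith
      calc Real.exp (-(‖β‖ + 2)) ≤ ‖w‖ / Real.exp 1 := by rw [← h2]; exact h1
        _ ≤ ‖w‖ / 2 := div_le_div_of_nonneg_left hw0.le (by norm_num) h3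
    have hlow : ‖w‖ / 2 ≤ ‖ξ‖ := by
      have := norm_sub_norm_le w (w - ξ)
      rw [sub_sub_cancel] at this
      linarith
    have hup : ‖ξ‖ ≤ 2 * M₀ := by
      have := norm_sub_le w (w - ξ)
      rw [sub_sub_cancel] at this
      linarith
    have hξ0 : 0 < ‖ξ‖ := by linarith
    refine ⟨norm_pos_iff.mp hξ0, hup, ?_⟩
    calc ‖ξ‖⁻¹ ≤ (‖w‖ / 2)⁻¹ := inv_anti₀ (by linarith) hlow
      _ = 2 * ‖w‖⁻¹ := by rw [inv_div, div_eq_mul_inv]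
      _ ≤ 2 * M₀ := by linarith

set_option maxHeartbeats 400000 in
/-- **The approximation measure for `e^β` of the shape of Theorem 3.8** ([NesterenkoWaldschmidt1996]
Theorem 1 with `θ = β`). For `β ≠ 0` algebraic there is `C₀ = C₀(β) ≥ 0` such that
`|e^β − ξ| ≥ exp{−C₀ n² Y (log Y + log n)² (log Y)⁻²}` for every root `ξ` of every irreducible
`Q ∈ ℤ[X]` of degree `n ≥ 1` and every `Y ≥ max(log 16, log M(Q))`; here
`C₀ = 1.28·10⁹ · g · d² (21 + log d + g + C_h)²` with `d = [ℚ(β):ℚ]`, `g = d + ⌈‖β‖⌉ + 1` and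
`C_h` a bound for the heights `h_F(β)`.
Proof: suppose `|e^β − ξ| < exp(−Φ)`, `Φ = C₀ n² Y (log Y + log n)²/(log Y)²`. Then `ξ ≠ 0` and
`|ξ|^{±1}, |e^β|^{±1} ≤ B` (`exists_B`); in `F = ℚ(β) ⊔ ℚ(ξ)` one has `[F:ℚ] ≤ d n`,
`[F:ℚ] h(β) ≤ d n C_h`, `[F:ℚ] h(ξ) ≤ d log M(Q) ≤ d Y` (`weilHeight₁_root_le`); with the
parameters of part IV (`exists_Lambda`, `exists_V`, `counts`, `main_ineq`) and the smallness
`T₁S₁ · B^{3T₁S₁} · |ξ − e^β| · Y^L ≤ exp(Φ) exp(−Φ) = 1` (`smallness_budget`, `unit_le_final`),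
`approx_core` (part III) is contradicted.
[cite: Waldschmidt1978, Theorem 3.8 (p. 455); NesterenkoWaldschmidt1996, Theorem 1 (§1)] -/
theorem approx_measure_exp_alg (β : ℂ) (hβ : IsAlgebraic ℚ β) (hβ0 : β ≠ 0) :
    ∃ C₀ : ℝ, 0 ≤ C₀ ∧ ∀ Q : ℤ[X], Irreducible Q → 0 < Q.natDegree → ∀ ξ : ℂ, aeval ξ Q = 0 →
      ∀ Y : ℝ, Real.log 16 ≤ Y → Real.log (Q.map (Int.castRingHom ℂ)).mahlerMeasure ≤ Y →
        Real.exp (-(C₀ * (Q.natDegree : ℝ) ^ 2 * Y *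
          (Real.log Y + Real.log Q.natDegree) ^ 2 / Real.log Y ^ 2)) ≤ ‖cexp β - ξ‖ := by
  classical
  -- data attached to `β`: `ℚ(β)`, `dβ = [ℚ(β):ℚ]`, a height bound `Ch`, the bound `B`, `g`
  obtain ⟨Kβ, hKβ⟩ : ∃ K : IntermediateField ℚ ℂ, K = IntermediateField.adjoin ℚ ({β} : Set ℂ) :=
    ⟨_, rfl⟩
  have hβK : β ∈ Kβ := by rw [hKβ]; exact IntermediateField.mem_adjoin_simple_self ℚ β
  haveI hKβfd : FiniteDimensional ℚ Kβ := by
    rw [hKβ]; exact IntermediateField.adjoin.finiteDimensional hβ.isIntegral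
  obtain ⟨dβ, hdβ⟩ : ∃ d : ℕ, d = Module.finrank ℚ Kβ := ⟨_, rfl⟩
  have hdβ1 : 1 ≤ dβ := by rw [hdβ]; exact Module.finrank_pos
  have hdβr : (1 : ℝ) ≤ dβ := by exact_mod_cast hdβ1
  have hlogd : 0 ≤ Real.log (dβ : ℝ) := Real.log_nonneg hdβr
  obtain ⟨Ch, hCh0, hCh⟩ := exists_weilHeight₁_le_of_isAlgebraic hβ
  obtain ⟨B, hB1, hwB, hwB', hlB0, hlB1, hBξ⟩ := exists_B β
  obtain ⟨g, hg⟩ : ∃ g : ℕ, g = dβ + ⌈‖β‖⌉₊ + 1 := ⟨_, rfl⟩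
  have hgr : (g : ℝ) = dβ + ⌈‖β‖⌉₊ + 1 := by rw [hg]; norm_cast
  have hceil : ‖β‖ ≤ ⌈‖β‖⌉₊ := Nat.le_ceil _
  have hceil0 : (0 : ℝ) ≤ ⌈‖β‖⌉₊ := Nat.cast_nonneg _
  have hg1 : (1 : ℝ) ≤ g := by rw [hgr]; linarith
  have hgβ : ‖β‖ + 2 ≤ g := by rw [hgr]; linarith
  have hβp1 : 1 ≤ max 1 ‖β‖ := le_max_left _ _
  have hβpg : max 1 ‖β‖ ≤ g := max_le hg1 (by linarith)
  have hdβ0 : (0 : ℝ) ≤ dβ := by linarith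
  have hdβg : (dβ : ℝ) ≤ g := by rw [hgr]; linarith
  have hlBg : Real.log B ≤ 2 * g := by linarith
  have hκ0 : 0 ≤ 20 + (g : ℝ) + Ch := by linarith
  obtain ⟨C₀, hC₀⟩ : ∃ C₀ : ℝ,
      C₀ = 1280000000 * g * (dβ : ℝ) ^ 2 * (1 + Real.log dβ + (20 + g + Ch)) ^ 2 := ⟨_, rfl⟩
  have hC₀0 : 0 ≤ C₀ := by rw [hC₀]; positivity
  refine ⟨C₀, hC₀0, ?_⟩
  intro Q hQ hn ξ hξ Y hY hM
  -- basic real quantities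
  have hn1 : (1 : ℝ) ≤ Q.natDegree := by exact_mod_cast hn
  have hn0 : (0 : ℝ) < Q.natDegree := by linarith
  have h16 := one_lt_log_sixteen
  have hY1 : 1 ≤ Y := by linarith
  have hY0 : 0 < Y := by linarith
  have ha1 : 1 ≤ Real.log Y :=
    le_trans (one_lt_log_log (le_refl (16 : ℝ))).le (Real.log_le_log (by linarith) hY)
  have ha0 : 0 < Real.log Y := by linarith
  have hlogn : 0 ≤ Real.log (Q.natDegree : ℝ) := Real.log_nonneg hn1
  obtain ⟨Φ, hΦ⟩ : ∃ Φ : ℝ, Φ = C₀ * (Q.natDegree : ℝ) ^ 2 * Y *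
      (Real.log Y + Real.log Q.natDegree) ^ 2 / Real.log Y ^ 2 := ⟨_, rfl⟩
  rw [← hΦ]
  by_contra hlt
  rw [not_le] at hlt
  -- `Φ ≥ C₀ ≥ g ≥ ‖β‖ + 2`, so `ξ` is close to `e^β`: `ξ ≠ 0` and `|ξ|^{±1} ≤ B`
  have hC₀g : (g : ℝ) ≤ C₀ := by
    rw [hC₀]
    have h1 : (1 : ℝ) ≤ (dβ : ℝ) ^ 2 := one_le_pow₀ hdβr
    have h2 : (1 : ℝ) ≤ (1 + Real.log dβ + (20 + g + Ch)) ^ 2 := one_le_pow₀ (by linarith)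
    have h3 : (g : ℝ) ≤ 1280000000 * g := by linarith
    calc (g : ℝ) = g * 1 * 1 := by ring
      _ ≤ 1280000000 * g * (dβ : ℝ) ^ 2 * (1 + Real.log dβ + (20 + g + Ch)) ^ 2 :=
          mul_le_mul (mul_le_mul h3 h1 zero_le_one (by positivity)) h2 zero_le_one
            (by positivity)
  have hΦC : C₀ ≤ Φ := by
    rw [hΦ, le_div_iff₀ (pow_pos ha0 2)]
    have h1 : Real.log Y ^ 2 ≤ (Real.log Y + Real.log Q.natDegree) ^ 2 :=
      pow_le_pow_left₀ ha0.le (by linarith) 2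
    have h2 : (1 : ℝ) ≤ (Q.natDegree : ℝ) ^ 2 * Y :=
      one_le_mul_of_one_le_of_one_le (one_le_pow₀ hn1) hY1
    calc C₀ * Real.log Y ^ 2 = C₀ * 1 * Real.log Y ^ 2 := by ring
      _ ≤ C₀ * ((Q.natDegree : ℝ) ^ 2 * Y) * (Real.log Y + Real.log Q.natDegree) ^ 2 :=
          mul_le_mul (mul_le_mul_of_nonneg_left h2 hC₀0) h1 (sq_nonneg _)
            (mul_nonneg hC₀0 (mul_nonneg (sq_nonneg _) hY0.le))
      _ = C₀ * (Q.natDegree : ℝ) ^ 2 * Y * (Real.log Y + Real.log Q.natDegree) ^ 2 := by ring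
  have hclose : ‖cexp β - ξ‖ ≤ Real.exp (-(‖β‖ + 2)) :=
    le_trans hlt.le (Real.exp_le_exp.mpr (by linarith))
  obtain ⟨hξ0, hξB, hξB'⟩ := hBξ ξ hclose
  -- the field `F = ℚ(β) ⊔ ℚ(ξ)`
  obtain ⟨Kξ, hKξ⟩ : ∃ K : IntermediateField ℚ ℂ, K = IntermediateField.adjoin ℚ ({ξ} : Set ℂ) :=
    ⟨_, rfl⟩
  have hξK : ξ ∈ Kξ := by rw [hKξ]; exact IntermediateField.mem_adjoin_simple_self ℚ ξ
  have hKξn : Module.finrank ℚ Kξ = Q.natDegree := by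
    rw [hKξ]; exact NesterenkoWaldschmidt1996.finrank_adjoin_eq_natDegree hQ hn hξ
  haveI hKξfd : FiniteDimensional ℚ Kξ := Module.finite_of_finrank_pos (by rw [hKξn]; exact hn)
  obtain ⟨F, hF⟩ : ∃ F : IntermediateField ℚ ℂ, F = Kβ ⊔ Kξ := ⟨_, rfl⟩
  haveI hFfd : FiniteDimensional ℚ F := by
    rw [hF]; exact IntermediateField.finiteDimensional_sup Kβ Kξ
  have hβF : β ∈ F := by rw [hF]; exact (le_sup_left : Kβ ≤ Kβ ⊔ Kξ) hβK
  have hξF : ξ ∈ F := by rw [hF]; exact (le_sup_right : Kξ ≤ Kβ ⊔ Kξ) hξK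
  have hfin : (Module.finrank ℚ F : ℝ) ≤ (dβ : ℝ) * Q.natDegree := by
    have h := IntermediateField.finrank_sup_le Kβ Kξ
    rw [← hF, hKξn, ← hdβ] at h
    exact_mod_cast h
  have hHβ : (Module.finrank ℚ F : ℝ) * weilHeight₁ F (fun _ : Unit => β) ≤
      (dβ : ℝ) * Q.natDegree * Ch :=
    mul_le_mul hfin (hCh F hβF) (weilHeight₁_nonneg F _) (by positivity)
  have hHξ : (Module.finrank ℚ F : ℝ) * weilHeight₁ F (fun _ : Unit => ξ) ≤ (dβ : ℝ) * Y := by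
    have h1 := RoyWaldschmidt1997.MahlerWeil.weilHeight₁_root_le Q hQ hn hξ F hξF
    have h2 : (Module.finrank ℚ F : ℝ) * weilHeight₁ F (fun _ : Unit => ξ) ≤
        (dβ : ℝ) * Q.natDegree * (Real.log (Q.map (Int.castRingHom ℂ)).mahlerMeasure / Q.natDegree) :=
      mul_le_mul hfin h1 (weilHeight₁_nonneg F _) (by positivity)
    have h3 : (dβ : ℝ) * Q.natDegree *
        (Real.log (Q.map (Int.castRingHom ℂ)).mahlerMeasure / Q.natDegree) =
        dβ * Real.log (Q.map (Int.castRingHom ℂ)).mahlerMeasure := by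
      rw [mul_assoc, mul_div_cancel₀ _ hn0.ne']
    rw [h3] at h2
    exact le_trans h2 (mul_le_mul_of_nonneg_left hM hdβ0)
  -- the parameters of part IV
  have hD1 : (1 : ℝ) ≤ (dβ : ℝ) * Q.natDegree := one_le_mul_of_one_le_of_one_le hdβr hn1
  obtain ⟨Λ, hΛ1, hK, haΛ⟩ :=
    exists_Lambda (D := (dβ : ℝ) * Q.natDegree) (κ := 20 + (g : ℝ) + Ch) ha1 hD1 hκ0
  obtain ⟨V, hV1, hYaV, haV, hlogV⟩ := exists_V hY
  obtain ⟨T₁, hT₁n⟩ : ∃ T₁ : ℕ, T₁ = 100 * (dβ * Q.natDegree) * Λ := ⟨_, rfl⟩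
  obtain ⟨S₁, hS₁n⟩ : ∃ S₁ : ℕ, S₁ = 2500 * (dβ * Q.natDegree) * Λ := ⟨_, rfl⟩
  obtain ⟨T, hTn⟩ : ∃ T : ℕ, T = 250000 * g * (dβ * Q.natDegree) * V * Λ := ⟨_, rfl⟩
  obtain ⟨S, hSn⟩ : ∃ S : ℕ, S = 130000 * g * (dβ * Q.natDegree) * V * Λ := ⟨_, rfl⟩
  have hT₁ : (T₁ : ℝ) = 100 * ((dβ : ℝ) * Q.natDegree) * Λ := by rw [hT₁n]; push_cast; ring
  have hS₁ : (S₁ : ℝ) = 2500 * ((dβ : ℝ) * Q.natDegree) * Λ := by rw [hS₁n]; push_cast; ring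
  have hT : (T : ℝ) = 250000 * (g : ℝ) * ((dβ : ℝ) * Q.natDegree) * V * Λ := by
    rw [hTn]; push_cast; ring
  have hS : (S : ℝ) = 130000 * (g : ℝ) * ((dβ : ℝ) * Q.natDegree) * V * Λ := by
    rw [hSn]; push_cast; ring
  obtain ⟨hT₁1, hS₁1, h2T₁, hcount⟩ := counts hD1 hg1 hΛ1 hV1 hT₁ hS₁ hT hS
  have hmain := main_ineq hD1 hg1 hΛ1 hV1 hCh0 hβp1 hβpg hdβ0 hdβg hY ha1 hYaV hlB0 hlBg hlogV
    hK hT₁ hS₁ hT hS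
  -- smallness of the perturbation: `T₁S₁ · B^{3T₁S₁} · |ξ − e^β| · Y^L ≤ 1`
  have hbudget := smallness_budget (lB := Real.log B) hD1 hg1 ha1 hΛ1 hV1 hlBg hT₁ hS₁ hT
  have hunit := unit_le_final (Y := Y) hdβr hn1 hg1 ha1 hΛ1 hV1 hκ0 haV haΛ
  have hsumΦ : (((T + 1) * (2 * T₁ + 1) : ℕ) : ℝ) * Real.log Y + Real.log ((T₁ * S₁ : ℕ) : ℝ) +
      3 * ((T₁ * S₁ : ℕ) : ℝ) * Real.log B ≤ Φ := by
    refine le_trans hbudget (le_trans (mul_le_mul_of_nonneg_left hunit (by norm_num)) (le_of_eq ?_))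
    rw [hΦ, hC₀]; ring
  have hN1 : 1 ≤ T₁ * S₁ := le_trans (by norm_num) (Nat.mul_le_mul hT₁1 hS₁1)
  have hNpos : (0 : ℝ) < ((T₁ * S₁ : ℕ) : ℝ) := by exact_mod_cast hN1
  have hB0 : 0 < B := by linarith
  have hBpow : 0 < B ^ (3 * (T₁ * S₁)) := pow_pos hB0 _
  have hYpow : 0 < Y ^ ((T + 1) * (2 * T₁ + 1)) := pow_pos hY0 _
  have hX : ((T₁ * S₁ : ℕ) : ℝ) * B ^ (3 * (T₁ * S₁)) * Y ^ ((T + 1) * (2 * T₁ + 1)) ≤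
      Real.exp Φ := by
    rw [← Real.log_le_iff_le_exp (mul_pos (mul_pos hNpos hBpow) hYpow),
      Real.log_mul (mul_pos hNpos hBpow).ne' hYpow.ne', Real.log_mul hNpos.ne' hBpow.ne',
      Real.log_pow, Real.log_pow]
    push_cast at hsumΦ ⊢
    linarith
  have hδ : ((T₁ * S₁ : ℕ) : ℝ) * B ^ (3 * (T₁ * S₁)) * ‖ξ - cexp β‖ *
      Y ^ ((T + 1) * (2 * T₁ + 1)) ≤ 1 := by
    have hδ' : ‖ξ - cexp β‖ ≤ Real.exp (-Φ) := by rw [norm_sub_rev]; exact hlt.le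
    calc ((T₁ * S₁ : ℕ) : ℝ) * B ^ (3 * (T₁ * S₁)) * ‖ξ - cexp β‖ * Y ^ ((T + 1) * (2 * T₁ + 1))
        = ((T₁ * S₁ : ℕ) : ℝ) * B ^ (3 * (T₁ * S₁)) * Y ^ ((T + 1) * (2 * T₁ + 1)) *
            ‖ξ - cexp β‖ := by ring
      _ ≤ Real.exp Φ * Real.exp (-Φ) := mul_le_mul hX hδ' (norm_nonneg _) (Real.exp_pos _).le
      _ = 1 := by rw [← Real.exp_add, add_neg_cancel, Real.exp_zero]
  exact (approx_core hβ0 hξ0 F hβF hξF hfin hHβ hHξ hT₁1 hS₁1 h2T₁ hcount hY1 hB1 hξB hξB' hwB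
    hwB' hδ hmain).elim

end Waldschmidt1978

/-- **Waldschmidt 1978, Corollary 3.9** — the named fact
`Literature.NumberTheory.Transcendental.Waldschmidt1978_cor_3_9` holds: for `β ≠ 0` algebraic
there is `C = C(β) > 0` with
`|P(e^β)| ≥ exp{−C N² (log H + log N)(log log H + log N)² (log log H + log₊ log N)⁻²}` for every
non-zero `P ∈ ℤ[X]` of degree `≤ N` and height `≤ H`, `H ≥ 16`. Proof: the approximation measure
`Waldschmidt1978.approx_measure_exp_alg` (Theorem 3.8) and the transference
`Waldschmidt1978_cor_3_9_of_approx` (Lemma 2.3). [cite: Waldschmidt1978, Corollary 3.9 (p. 455)] -/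
theorem Waldschmidt1978_cor_3_9_holds : Waldschmidt1978_cor_3_9 :=
  Waldschmidt1978_cor_3_9_of_approx fun β hβ hβ0 => Waldschmidt1978.approx_measure_exp_alg β hβ hβ0

end Literature.NumberTheory.Transcendental

end
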